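import Summits.QuantumFields.BalabanUV.Beta.GAN24.GaugeReadSourcePairing
import Summits.QuantumFields.BalabanUV.Beta.GAN24.ChargeTowerStep

/-!
# `BalabanUV.Beta.GAN24.GaugeReadSourcePairingSucc` — binder row G-an2-4 ∕ (CONV-C), the (S) row ∕ (W-γ), EXIT class, LEVELS `j + 1 ≥ 1`:
# **THE (γ)-TYPE SOURCE PAIRING ONE LEVEL UP, REDUCED TO THE COLUMN-CONTRACTED SECOND-LEG GAUGE PAIRING OF THE VALUE-FUNCTION CUBIC TABLE** —
# leaf-06 g47 FILE B (`GaugeReadSourcePairing.gaugeLeg_sourcePairing_dM`) ONE LEVEL UP, with the one NEW object isolated: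
# `Σ'_x Σ_κ₂ dzψ·(Σ'_u Σ_κ n κ u·𝒟_{j+1}(e) u x (inl κ)(inl κ₂)) = (cE·wE_{j+1})·X_{j+1}(n,ψ;e) − (cΛ·wM1_{j+1})·(2Lc^{d+1})⁻¹·Σ'_w Σ_κ 𝒬_{Lc}(σ_ψ⊙n) κ w·colM G_{j+1}(e) κ w`,
# `X_{j+1}(n,ψ;e) := Σ_l Σ'_t colH G_{j+1}(e) l t·(Σ'_{(u,x)} Σ_κ Σ_κ₂ n κ u·dzψ κ₂ x·e3OfK Lc G_j (SrecAt … j) l t u x (inl κ)(inl κ₂))`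
# (G-an2-4 CRUX TEAM (2), seat `b2b-balaban-gan24-formalise-leaf-06` = the (γ) hand, gen 48, FILE B″)

NOT IN PRINT; OUR BOOKKEEPING ([folklore] BY NAME over leaf-06 g47 FILE A `CombFreeGaugeLegCharges` (`hasSum_prod_weight_vertexOfK ∕ _vertexOfM`, `hasSum_prod_hessFFAt_gaugeLeg`,
`abs_bondSum_mul_le`), leaf-06 g45 `GaugeReadChargeDipole.abs_tsum_prod_le_of_biLoc` ∕ `GaugeReadChargeProfile.biLoc_weightMul` ∕ `KernelLegCharges.summable_prod_of_biLoc`, an2's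
`SecondOrderSplitDecay.summable_colH_mul_bdd ∕ summable_colM_mul_bdd`, an2's `ValueJetGeneric.locStencil_e3OfK`, d1-leaf-10's `WardLocusRecursive.locStencil_SrecAt`, leaf-02 g52's
`CubicPushFaceCharge.vhSAt_inl_inl`; 0 `def`, 0 cited fact, 0 `def … : Prop`, 0 sorry).
HONEST FRAMING (cell contract, verbatim): «discharging `BetaPertH` makes Bałaban's UV stability UNCONDITIONAL — a real constructive-QFT result; it is NOT the continuum limit and NOT
the Clay problem.»  HONEST DEPENDENCY (verbatim): «continuum YM on T⁴ ⇐ BetaPertH ∧ nine spine estimates (0/9 proved); BetaPertH ⇐ (D1) ∧ (D4) ∧ CAP+tail; G-an2-4 gates asym,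
D1 and NE2/3/4.»

WHY.  road-P2 g43's `ExitChargeSourcePairing` (the level-(j+1) twin of leaf-06 FILE C) makes the (γ) exit⊗exit charge of a slot one level up EQUAL to the source pairing
`Σ'_x Σ_κ₂ gaugeWt·(Σ'_u Σ_κ n_m·𝒟_{j+1}(e))` against the contour-free comb-free representative `n_m` of the tower's potential, and its §6 takes the CLOSED FORM of that pairing as the
one displayed hypothesis of (W-γ)_{j+1}.  At `jb = 0` FILE B evaluated the pairing from the explicit second-leg gauge laws of the level-0 tables.  One level up the tables are
`S_{j+1} = (cE·wE_{j+1})•e3OfK Lc G_j (SrecAt j) + (cVH·wVH_{j+1})•vhSAt` (`SpureRecAt_succ`) and `M_{j+1} = (cΛ·wM1_{j+1})•h^ρ` (`M1At`); the border table is off the ff block and the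
constraint-Hessian table obeys FILE A's law at every level, so the ONLY new object is the ℋ-COLUMN-CONTRACTED second-leg gauge pairing `X_{j+1}` of the value-function cubic table —
this file proves exactly that reduction (no closed form of `X_{j+1}` is asserted).  ENGINE E-leaf06-g48-1 (kit j174123 ∕ j174264 ∕ j174335 ∕ j174816; D = 2, Lc = 3; float64, decides
nothing here): for 1-block-periodic comb-free contour-free `n` and block-constant `ψ`, `X_1 = cE·cH_0·[−½·Σ' ψ⁺⊙colH G_1(e)⊙(E2_1 n) + ¼·Σ' σ_ψ⊙n⊙(E2_1 colH G_1(e))]` to 1e-13 (only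
the Wilson sector of `SrecAt 0` contributes), and the whole pairing is `−(cE∕2)·stepScale_J·R_end + ((cE∕4)·wVH_J − cΛ·wM1_J∕(2Lc^{d+1}))·Kσ` at the pins for `J = 0, 1, 2`; the
per-stencil-bond 4-term law of `e3OfK` FAILS (4e-2) — the contraction with the column is essential — and so does the shape for non-periodic `n` at `J ≥ 1` (3.7e-4, B = 3 and 5).
* §1 **`tsum_prod_gaugeLeg_vertexOfM_succ`** — THE MULTIPLIER-COLUMN SECTOR AT LEVEL `j+1`, CLOSED FORM (FILE B §2 verbatim with `M1At … (j+1)`):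
  `Σ'_{(u,x)} Σ_κ Σ_κ₂ n κ u·dzψ κ₂ x·vertexOfM G_{j+1} Lc M_{j+1} ν y′ u x (inl κ)(inl κ₂) = −(cΛ·wM1_{j+1})·(2Lc^{d+1})⁻¹·Σ'_w Σ_μ 𝒬_{Lc}(σ_ψ⊙n) μ w·colM G_{j+1}(e) μ w`.
* §2 `abs_tsum_prod_e3OfK_gaugeLeg_le` (the per-slot e3 gauge-leg charge is bounded uniformly in the slot), **`tsum_prod_gaugeLeg_vertexOfK_succ`** — THE ℋ-COLUMN SECTOR AT LEVEL
  `j+1` IS `(cE·wE_{j+1})·X_{j+1}` (FILE A's vertex Fubini, `SpureRecAt_succ`, `vhSAt_inl_inl`, `locStencil_e3OfK`).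
* §3 **`gaugeLeg_sourcePairing_dM_succ`** — THE REDUCTION (statement in the title), for `n` bounded, comb-free, contour-free, `ψ` bounded, every `j`, every slot, all `cE cVH cΛ`.
READING.  With road-P2 g43 `ExitChargeSourcePairing.gaugeCharge_exit_eq_sourcePairing` and this file, (W-γ)'s exit⊗exit identity at level `j+1` rests on ONE identity about `G_j`,
`G_{j+1}` and `SrecAt j`: the closed form of `X_{j+1}` for the tower's contour-free periodic potential (ENGINE: `cE·cH_0·[−½⟨ψ⁺colH, E2 n⟩ + ¼⟨σ n, E2 colH⟩]`-shape at `j = 0`; mechanism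
R-leaf06-g48-2: FILE A's Wilson letter column-contracted + two two-level response identities (C1)∕(C2)) and FILE D's cancellation for the explicit potential (road-P2 g43 INTENT 3).
Asserts NO value of any resolvent column and NO closed form of `X_{j+1}`; NOTHING of (W-γ) at levels ≥ 1 ∕ (INV) ∕ (S) ∕ (Q-R) ∕ «T2Shape» ∕ (hW, hWall) discharged; NEVER «G-an2-4
closed» as (CONV-C); NOT D1, NOT `BetaPertH`, NOT continuum, NOT Clay.  2026-08-22; no existing file touched.
-/

noncomputable section

open Finset
open scoped BigOperators
open Literature.MathematicalPhysics.QuantumFieldTheory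
open Literature.MathematicalPhysics.QuantumFieldTheory.Balaban1983to89
open Literature.MathematicalPhysics.QuantumFieldTheory.Balaban1983to89.Beta
open B12Sec2to5 (l1 l1_nonneg)
open ExpKernelCalculus (Site MKer Decays BiLoc VertexFamily Zl comp summable_exp_shift')
open AffineAveraging (Form0 Form1 box toSite unitVec unitVec_apply dz contourSum)
open AveragingHessianKernelsRooted (hessFFAt vhSAt)
open OneStepResolventKernel (Fib LocStencil decays_mono)
open AveragingHessianKernels (ell)
open OneStepKernelFamily (KInvStep colH vertexOfK decays_KInvStep)
open SecondOrderResponse (colM vertexOfM dM dM_apply vertexFamily_dM)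
open BalabanStepW2 (wM1)
open BalabanStepJetsSucc (wE wVH)
open Summit.QuantumFields.BalabanUV.Beta.TameKernelCalculus
open Summit.QuantumFields.BalabanUV.Beta.AxialDressingRooted (IsCombBondAt coDressKBmAt decays_coDressKBmAt decays_coDressKBmAt_KInvStep one_le_of_neZero)
open Summit.QuantumFields.BalabanUV.Beta.SpineRooted (SpureRecAt SpureRecAt_succ M1At e3OfK locStencil_SpureRecAt vertexFamily_M1At locStencil_e3OfK)
open Summit.QuantumFields.BalabanUV.Beta.WardLocusRecursive (SrecAt locStencil_SrecAt)
open Summit.QuantumFields.BalabanUV.Beta.GAN24.KernelLegCharges (summable_prod_of_biLoc)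
open Summit.QuantumFields.BalabanUV.Beta.GAN24.GaugeReadChargeDipole (abs_tsum_prod_le_of_biLoc)
open Summit.QuantumFields.BalabanUV.Beta.GAN24.GaugeReadChargeProfile (biLoc_weightMul)
open Summit.QuantumFields.BalabanUV.Beta.SecondOrderSplitDecay (summable_colH_mul_bdd summable_colM_mul_bdd)
open BalabanStepJets (locStencil_mono)
open Summit.QuantumFields.BalabanUV.Beta.GAN24.CombFreeGaugeLegCharges (hasSum_prod_hessFFAt_gaugeLeg hasSum_prod_weight_vertexOfK hasSum_prod_weight_vertexOfM abs_bondSum_mul_le)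
open Summit.QuantumFields.BalabanUV.Beta.GAN24.CubicPushFaceCharge (vhSAt_inl_inl)
open KKTFluctuationEnergy (abs_dz_le)

namespace Summit.QuantumFields.BalabanUV.Beta.GAN24.GaugeReadSourcePairingSucc

variable {d : ℕ}

/-! ## §1 The multiplier-column sector one level up -/

/-- NOT IN PRINT; OUR BOOKKEEPING.  **THE MULTIPLIER-COLUMN SECTOR OF THE SOURCE PAIRING AT LEVEL `j+1`, IN CLOSED FORM** (`M_{j+1} = M1At … (j+1) = (cΛ·wM1 (j+1))•h^ρ`; `n` comb-free
with VANISHING block contour sums and bounded; `ψ` bounded):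
`Σ'_{(u,x)} Σ_κ Σ_κ₂ n κ u·(dz ψ) κ₂ x·(vertexOfM G_{j+1} Lc M_{j+1} ν y′) u x (inl κ)(inl κ₂) = −(cΛ·wM1 (j+1))·(2Lc^{d+1})⁻¹·Σ'_w Σ_μ 𝒬_{Lc}(σ_ψ ⊙ n) μ w·colM G_{j+1} Lc ν y′ μ w`
— FILE B §2 verbatim one level up (FILE A's `hasSum_prod_hessFFAt_gaugeLeg` is level-independent). -/
theorem tsum_prod_gaugeLeg_vertexOfM_succ {Lc : ℕ} [NeZero Lc] {r : Fin (d + 1) → ℕ} (hr : r ∈ box (d + 1) Lc) (cΛ : ℝ) (j : ℕ) (ν : Fin (d + 1)) (y' : Site (d + 1))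
    {n : Form1 (d + 1) ℝ} {Bn : ℝ} (hnB : ∀ κ u, |n κ u| ≤ Bn) (hn0 : ∀ κ u, IsCombBondAt (toSite r) Lc κ u → n κ u = 0) (hq : ∀ κ y, contourSum Lc n κ y = 0)
    {ψ : Site (d + 1) → ℝ} {Bψ : ℝ} (hψ : ∀ u, |ψ u| ≤ Bψ) :
    ∑' ux : Site (d + 1) × Site (d + 1), ∑ κ, ∑ κ₂, n κ ux.1 * dz ψ κ₂ ux.2
        * vertexOfM (coDressKBmAt (toSite r) Lc (KInvStep (d := d) Lc (j + 1))) Lc (M1At d Lc (toSite r) cΛ (j + 1)) ν y' ux.1 ux.2 (Sum.inl κ) (Sum.inl κ₂)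
      = -(cΛ * wM1 d Lc (j + 1)) * (2 * (Lc : ℝ) ^ (d + 1))⁻¹ * ∑' w, ∑ μ, contourSum Lc (fun κ u => (ψ u + ψ (u + unitVec κ)) * n κ u) μ w
            * colM (coDressKBmAt (toSite r) Lc (KInvStep (d := d) Lc (j + 1))) Lc ν y' μ w := by
  classical
  have hLc : 1 ≤ Lc := one_le_of_neZero Lc
  set G := coDressKBmAt (toSite r) Lc (KInvStep (d := d) Lc (j + 1)) with hGdef
  set M := M1At d Lc (toSite r) cΛ (j + 1) with hMdef
  obtain ⟨δG, CG, hδG, hCG, hG⟩ := decays_coDressKBmAt_KInvStep (d := d) hr (j + 1)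
  have hM := vertexFamily_M1At (d := d) (Lc := Lc) hLc hr cΛ (j + 1) hδG.le
  set CM : ℝ := |cΛ * wM1 d Lc (j + 1)| * (2 * (ell (d + 1) Lc : ℝ) ^ 2 * Real.exp (4 * ((d : ℝ) + 1) * Lc * δG)) with hCMdef
  have hGK : ∃ δ C : ℝ, 0 < δ ∧ 0 ≤ C ∧ Decays G C δ := ⟨δG, CG, hδG, hCG, hG⟩
  have hBψ : 0 ≤ Bψ := (abs_nonneg _).trans (hψ 0)
  have hω : ∀ (κ κ₂ : Fin (d + 1)) (xz : Site (d + 1) × Site (d + 1)), |n κ xz.1 * dz ψ κ₂ xz.2| ≤ Bn * (2 * Bψ) := fun κ κ₂ xz => by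
    rw [abs_mul]; exact mul_le_mul (hnB κ xz.1) (abs_dz_le hψ κ₂ xz.2) (abs_nonneg _) ((abs_nonneg _).trans (hnB κ xz.1))
  have h1 : ∀ κ κ₂ : Fin (d + 1), HasSum (fun ux : Site (d + 1) × Site (d + 1) => (n κ ux.1 * dz ψ κ₂ ux.2) * vertexOfM G Lc M ν y' ux.1 ux.2 (Sum.inl κ) (Sum.inl κ₂))
      (∑ μ, ∑' w, colM G Lc ν y' μ w * ∑' ux : Site (d + 1) × Site (d + 1), (n κ ux.1 * dz ψ κ₂ ux.2) * M μ w ux.1 ux.2 (Sum.inl κ) (Sum.inl κ₂)) :=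
    fun κ κ₂ => hasSum_prod_weight_vertexOfM hLc hG hCG hM hδG le_rfl (hω κ κ₂) ν y' (Sum.inl κ) (Sum.inl κ₂)
  have hsum := hasSum_sum fun κ (_ : κ ∈ (Finset.univ : Finset (Fin (d + 1)))) =>
    hasSum_sum fun κ₂ (_ : κ₂ ∈ (Finset.univ : Finset (Fin (d + 1)))) => h1 κ κ₂
  have eL : (fun ux : Site (d + 1) × Site (d + 1) => ∑ κ, ∑ κ₂, n κ ux.1 * dz ψ κ₂ ux.2 * vertexOfM G Lc M ν y' ux.1 ux.2 (Sum.inl κ) (Sum.inl κ₂))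
      = fun ux => ∑ κ ∈ Finset.univ, ∑ κ₂ ∈ Finset.univ, (n κ ux.1 * dz ψ κ₂ ux.2) * vertexOfM G Lc M ν y' ux.1 ux.2 (Sum.inl κ) (Sum.inl κ₂) := by
    funext ux; rfl
  rw [eL, hsum.tsum_eq]
  -- the slot charges of the rooted constraint-Hessian tables
  have hZ : ∀ μ w, (∑ κ, ∑ κ₂, ∑' ux : Site (d + 1) × Site (d + 1), (n κ ux.1 * dz ψ κ₂ ux.2) * M μ w ux.1 ux.2 (Sum.inl κ) (Sum.inl κ₂))
      = (cΛ * wM1 d Lc (j + 1)) * (-((2 * (Lc : ℝ) ^ (d + 1))⁻¹ * contourSum Lc (fun κ u => (ψ u + ψ (u + unitVec κ)) * n κ u) μ w)) := by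
    intro μ w
    have hs : ∀ κ κ₂, Summable fun ux : Site (d + 1) × Site (d + 1) => (n κ ux.1 * dz ψ κ₂ ux.2) * M μ w ux.1 ux.2 (Sum.inl κ) (Sum.inl κ₂) :=
      fun κ κ₂ => summable_prod_of_biLoc (biLoc_weightMul (hM μ w) (hω κ κ₂)) hδG (Sum.inl κ) (Sum.inl κ₂)
    have eκ : (∑ κ, ∑ κ₂, ∑' ux : Site (d + 1) × Site (d + 1), (n κ ux.1 * dz ψ κ₂ ux.2) * M μ w ux.1 ux.2 (Sum.inl κ) (Sum.inl κ₂))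
        = ∑' ux : Site (d + 1) × Site (d + 1), ∑ κ, ∑ κ₂, (n κ ux.1 * dz ψ κ₂ ux.2) * M μ w ux.1 ux.2 (Sum.inl κ) (Sum.inl κ₂) := by
      rw [Summable.tsum_finsetSum (fun κ _ => summable_sum fun κ₂ _ => hs κ κ₂)]
      exact Finset.sum_congr rfl fun κ _ => (Summable.tsum_finsetSum (fun κ₂ _ => hs κ κ₂)).symm
    rw [eκ]
    have e : ∀ ux : Site (d + 1) × Site (d + 1), (∑ κ, ∑ κ₂, (n κ ux.1 * dz ψ κ₂ ux.2) * M μ w ux.1 ux.2 (Sum.inl κ) (Sum.inl κ₂))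
        = (cΛ * wM1 d Lc (j + 1)) * ∑ κ, ∑ κ₂, n κ ux.1 * dz ψ κ₂ ux.2 * hessFFAt (toSite r) Lc μ w ux.1 ux.2 (Sum.inl κ) (Sum.inl κ₂) := by
      intro ux
      rw [Finset.mul_sum]
      refine Finset.sum_congr rfl fun κ _ => ?_
      rw [Finset.mul_sum]
      refine Finset.sum_congr rfl fun κ₂ _ => ?_
      rw [hMdef]
      simp only [M1At, Pi.smul_apply, smul_eq_mul]
      ring
    rw [tsum_congr e, tsum_mul_left, (hasSum_prod_hessFFAt_gaugeLeg hLc hr μ w hn0 hq ψ).tsum_eq]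
  have hZb : ∀ (κ κ₂ μ : Fin (d + 1)) (w : Site (d + 1)),
      |∑' ux : Site (d + 1) × Site (d + 1), (n κ ux.1 * dz ψ κ₂ ux.2) * M μ w ux.1 ux.2 (Sum.inl κ) (Sum.inl κ₂)| ≤ Bn * (2 * Bψ) * CM * (Zl (d + 1) δG * Zl (d + 1) δG) :=
    fun κ κ₂ μ w => abs_tsum_prod_le_of_biLoc (biLoc_weightMul (hM μ w) (hω κ κ₂)) hδG (Sum.inl κ) (Sum.inl κ₂)
  have hsZ : ∀ κ κ₂ μ, Summable fun w => colM G Lc ν y' μ w * ∑' ux : Site (d + 1) × Site (d + 1), (n κ ux.1 * dz ψ κ₂ ux.2) * M μ w ux.1 ux.2 (Sum.inl κ) (Sum.inl κ₂) :=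
    fun κ κ₂ μ => summable_colM_mul_bdd (N := Lc) hGK (hZb κ κ₂ μ) ν y' μ
  have c1 : (∑ κ, ∑ κ₂, ∑ μ, ∑' w, colM G Lc ν y' μ w * ∑' ux : Site (d + 1) × Site (d + 1), (n κ ux.1 * dz ψ κ₂ ux.2) * M μ w ux.1 ux.2 (Sum.inl κ) (Sum.inl κ₂))
      = ∑ μ, ∑ κ, ∑ κ₂, ∑' w, colM G Lc ν y' μ w * ∑' ux : Site (d + 1) × Site (d + 1), (n κ ux.1 * dz ψ κ₂ ux.2) * M μ w ux.1 ux.2 (Sum.inl κ) (Sum.inl κ₂) := by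
    calc (∑ κ, ∑ κ₂, ∑ μ, ∑' w, colM G Lc ν y' μ w * ∑' ux : Site (d + 1) × Site (d + 1), (n κ ux.1 * dz ψ κ₂ ux.2) * M μ w ux.1 ux.2 (Sum.inl κ) (Sum.inl κ₂))
        = ∑ κ, ∑ μ, ∑ κ₂, ∑' w, colM G Lc ν y' μ w * ∑' ux : Site (d + 1) × Site (d + 1), (n κ ux.1 * dz ψ κ₂ ux.2) * M μ w ux.1 ux.2 (Sum.inl κ) (Sum.inl κ₂) :=
          Finset.sum_congr rfl fun κ _ => Finset.sum_comm
      _ = _ := Finset.sum_comm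
  rw [c1]
  have c2 : ∀ μ w, (∑ κ, ∑ κ₂, colM G Lc ν y' μ w * ∑' ux : Site (d + 1) × Site (d + 1), (n κ ux.1 * dz ψ κ₂ ux.2) * M μ w ux.1 ux.2 (Sum.inl κ) (Sum.inl κ₂))
      = colM G Lc ν y' μ w * ((cΛ * wM1 d Lc (j + 1)) * (-((2 * (Lc : ℝ) ^ (d + 1))⁻¹ * contourSum Lc (fun κ u => (ψ u + ψ (u + unitVec κ)) * n κ u) μ w))) := by
    intro μ w
    rw [← hZ μ w, Finset.mul_sum]
    exact Finset.sum_congr rfl fun κ _ => by rw [Finset.mul_sum]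
  have c3 : ∀ μ, (∑ κ, ∑ κ₂, ∑' w, colM G Lc ν y' μ w * ∑' ux : Site (d + 1) × Site (d + 1), (n κ ux.1 * dz ψ κ₂ ux.2) * M μ w ux.1 ux.2 (Sum.inl κ) (Sum.inl κ₂))
      = ∑' w, colM G Lc ν y' μ w * ((cΛ * wM1 d Lc (j + 1)) * (-((2 * (Lc : ℝ) ^ (d + 1))⁻¹ * contourSum Lc (fun κ u => (ψ u + ψ (u + unitVec κ)) * n κ u) μ w))) := by
    intro μ
    rw [← tsum_congr (c2 μ), Summable.tsum_finsetSum (fun κ _ => summable_sum fun κ₂ _ => hsZ κ κ₂ μ)]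
    exact Finset.sum_congr rfl fun κ _ => (Summable.tsum_finsetSum (fun κ₂ _ => hsZ κ κ₂ μ)).symm
  simp only [c3]
  -- collect the constant
  have hσB : ∀ κ u, |(fun κ u => (ψ u + ψ (u + unitVec κ)) * n κ u) κ u| ≤ 2 * Bψ * Bn := fun κ u => abs_bondSum_mul_le hψ hnB κ u
  have hQb : ∀ μ w, |contourSum Lc (fun κ u => (ψ u + ψ (u + unitVec κ)) * n κ u) μ w| ≤ ∑ b ∈ box (d + 1) Lc, ∑ s ∈ Finset.range Lc, 2 * Bψ * Bn := by
    intro μ w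
    simp only [AffineAveraging.contourSum]
    exact (Finset.abs_sum_le_sum_abs _ _).trans (Finset.sum_le_sum fun b _ => (Finset.abs_sum_le_sum_abs _ _).trans (Finset.sum_le_sum fun s _ => hσB μ _))
  have hsQ : ∀ μ, Summable fun w => colM G Lc ν y' μ w * contourSum Lc (fun κ u => (ψ u + ψ (u + unitVec κ)) * n κ u) μ w :=
    fun μ => summable_colM_mul_bdd (N := Lc) hGK (hQb μ) ν y' μ
  have c4 : ∀ μ, (∑' w, colM G Lc ν y' μ w * ((cΛ * wM1 d Lc (j + 1)) * (-((2 * (Lc : ℝ) ^ (d + 1))⁻¹ * contourSum Lc (fun κ u => (ψ u + ψ (u + unitVec κ)) * n κ u) μ w))))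
      = (-(cΛ * wM1 d Lc (j + 1)) * (2 * (Lc : ℝ) ^ (d + 1))⁻¹) * ∑' w, contourSum Lc (fun κ u => (ψ u + ψ (u + unitVec κ)) * n κ u) μ w * colM G Lc ν y' μ w := by
    intro μ
    rw [← tsum_mul_left]
    exact tsum_congr fun w => by ring
  simp only [c4]
  rw [← Finset.mul_sum, Summable.tsum_finsetSum (fun μ _ => (hsQ μ).congr fun w => mul_comm _ _)]

/-! ## §2 The ℋ-column sector one level up: the column-contracted second-leg gauge pairing of the value-function cubic table -/

/-- NOT IN PRINT; OUR BOOKKEEPING.  **THE ℋ-COLUMN SECTOR OF THE SOURCE PAIRING AT LEVEL `j+1` IS `(cE·wE_{j+1})·X_{j+1}`** (in-block root; `G_{j+1} = coDressKBmAt ρ Lc (KInvStep Lc (j+1))`,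
`S_{j+1} = SpureRecAt … (j+1) = (cE·wE_{j+1})•e3OfK Lc G_j (SrecAt … j) + (cVH·wVH_{j+1})•vhSAt`; `n`, `ψ` bounded):
`Σ'_{(u,x)} Σ_κ Σ_κ₂ n κ u·dzψ κ₂ x·vertexOfK G_{j+1} Lc S_{j+1} ν y′ u x (inl κ)(inl κ₂) = (cE·wE_{j+1})·Σ_l Σ'_t colH G_{j+1}(e) l t·(Σ'_{(u,x)} Σ_κ Σ_κ₂ n κ u·dzψ κ₂ x·e3OfK Lc G_j (SrecAt j) l t u x (inl κ)(inl κ₂))`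
— FILE A's vertex Fubini (`hasSum_prod_weight_vertexOfK`), `SpureRecAt_succ`, the border table off the ff block (`vhSAt_inl_inl`), `locStencil_e3OfK` for the slot-uniform bound. -/
theorem tsum_prod_gaugeLeg_vertexOfK_succ {Lc : ℕ} [NeZero Lc] {r : Fin (d + 1) → ℕ} (hr : r ∈ box (d + 1) Lc) (cE cVH cΛ : ℝ) (j : ℕ) (ν : Fin (d + 1)) (y' : Site (d + 1))
    {n : Form1 (d + 1) ℝ} {Bn : ℝ} (hnB : ∀ κ u, |n κ u| ≤ Bn) {ψ : Site (d + 1) → ℝ} {Bψ : ℝ} (hψ : ∀ u, |ψ u| ≤ Bψ) :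
    ∑' ux : Site (d + 1) × Site (d + 1), ∑ κ, ∑ κ₂, n κ ux.1 * dz ψ κ₂ ux.2
        * vertexOfK (coDressKBmAt (toSite r) Lc (KInvStep (d := d) Lc (j + 1))) Lc (SpureRecAt d Lc (toSite r) cE cVH cΛ (j + 1)) ν y' ux.1 ux.2 (Sum.inl κ) (Sum.inl κ₂)
      = (cE * wE d Lc (j + 1)) * ∑ l, ∑' t, colH (coDressKBmAt (toSite r) Lc (KInvStep (d := d) Lc (j + 1))) Lc ν y' l t
          * ∑' ux : Site (d + 1) × Site (d + 1), ∑ κ, ∑ κ₂, n κ ux.1 * dz ψ κ₂ ux.2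
              * e3OfK Lc (coDressKBmAt (toSite r) Lc (KInvStep (d := d) Lc j)) (SrecAt d Lc (toSite r) cE cVH cΛ j) l t ux.1 ux.2 (Sum.inl κ) (Sum.inl κ₂) := by
  classical
  have hLc : 1 ≤ Lc := one_le_of_neZero Lc
  set G := coDressKBmAt (toSite r) Lc (KInvStep (d := d) Lc (j + 1)) with hGdef
  set S := SpureRecAt d Lc (toSite r) cE cVH cΛ (j + 1) with hSdef
  set E3 := e3OfK Lc (coDressKBmAt (toSite r) Lc (KInvStep (d := d) Lc j)) (SrecAt d Lc (toSite r) cE cVH cΛ j) with hE3def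
  obtain ⟨δG, CG, hδG, hCG, hG⟩ := decays_coDressKBmAt_KInvStep (d := d) hr (j + 1)
  obtain ⟨Cs, δs, hδs, hS⟩ := locStencil_SpureRecAt (d := d) (Lc := Lc) hLc hr cE cVH cΛ (j + 1)
  have hCs : 0 ≤ Cs := (hS 0 0).nonneg (Sum.inl 0)
  set δ : ℝ := min δs δG with hδdef
  have hδ : 0 < δ := lt_min hδs hδG
  have hSδ : LocStencil S Cs δ := locStencil_mono hS hCs (min_le_left _ _)
  have hGK : ∃ δ C : ℝ, 0 < δ ∧ 0 ≤ C ∧ Decays G C δ := ⟨δG, CG, hδG, hCG, hG⟩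
  -- the cubic table one level up is a local stencil family (decay of `G_j`, locality of `SrecAt j`)
  obtain ⟨Cr, δr, hδr, hSr⟩ := locStencil_SrecAt (d := d) (Lc := Lc) hLc hr cE cVH cΛ j
  obtain ⟨C₃, δ₃, hδ₃, hE3⟩ := locStencil_e3OfK (N := Lc) hLc (decays_coDressKBmAt_KInvStep (d := d) hr j) hSr hδr
  -- the two-leg weights, one per channel
  have hBψ : 0 ≤ Bψ := (abs_nonneg _).trans (hψ 0)
  have hω : ∀ (κ κ₂ : Fin (d + 1)) (xz : Site (d + 1) × Site (d + 1)), |n κ xz.1 * dz ψ κ₂ xz.2| ≤ Bn * (2 * Bψ) := fun κ κ₂ xz => by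
    rw [abs_mul]; exact mul_le_mul (hnB κ xz.1) (abs_dz_le hψ κ₂ xz.2) (abs_nonneg _) ((abs_nonneg _).trans (hnB κ xz.1))
  have h1 : ∀ κ κ₂ : Fin (d + 1), HasSum (fun ux : Site (d + 1) × Site (d + 1) => (n κ ux.1 * dz ψ κ₂ ux.2) * vertexOfK G Lc S ν y' ux.1 ux.2 (Sum.inl κ) (Sum.inl κ₂))
      (∑ l, ∑' t, colH G Lc ν y' l t * ∑' ux : Site (d + 1) × Site (d + 1), (n κ ux.1 * dz ψ κ₂ ux.2) * S l t ux.1 ux.2 (Sum.inl κ) (Sum.inl κ₂)) :=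
    fun κ κ₂ => hasSum_prod_weight_vertexOfK hG hCG hSδ hδ (min_le_right _ _) (hω κ κ₂) ν y' (Sum.inl κ) (Sum.inl κ₂)
  have hsum := hasSum_sum fun κ (_ : κ ∈ (Finset.univ : Finset (Fin (d + 1)))) =>
    hasSum_sum fun κ₂ (_ : κ₂ ∈ (Finset.univ : Finset (Fin (d + 1)))) => h1 κ κ₂
  have eL : (fun ux : Site (d + 1) × Site (d + 1) => ∑ κ, ∑ κ₂, n κ ux.1 * dz ψ κ₂ ux.2 * vertexOfK G Lc S ν y' ux.1 ux.2 (Sum.inl κ) (Sum.inl κ₂))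
      = fun ux => ∑ κ ∈ Finset.univ, ∑ κ₂ ∈ Finset.univ, (n κ ux.1 * dz ψ κ₂ ux.2) * vertexOfK G Lc S ν y' ux.1 ux.2 (Sum.inl κ) (Sum.inl κ₂) := by
    funext ux; rfl
  rw [eL, hsum.tsum_eq]
  -- per slot: only the cubic sector survives on the ff block
  have hZ : ∀ (κ κ₂ l : Fin (d + 1)) (t : Site (d + 1)), (∑' ux : Site (d + 1) × Site (d + 1), (n κ ux.1 * dz ψ κ₂ ux.2) * S l t ux.1 ux.2 (Sum.inl κ) (Sum.inl κ₂))
      = (cE * wE d Lc (j + 1)) * ∑' ux : Site (d + 1) × Site (d + 1), (n κ ux.1 * dz ψ κ₂ ux.2) * E3 l t ux.1 ux.2 (Sum.inl κ) (Sum.inl κ₂) := by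
    intro κ κ₂ l t
    rw [← tsum_mul_left]
    refine tsum_congr fun ux => ?_
    rw [hSdef, hE3def]
    simp only [SpureRecAt_succ, Pi.add_apply, Pi.smul_apply, smul_eq_mul, vhSAt_inl_inl, mul_zero, add_zero]
    ring
  simp only [hZ]
  -- bounds for the summabilities in `t`
  have hE3b : ∀ (κ κ₂ l : Fin (d + 1)) (t : Site (d + 1)),
      |∑' ux : Site (d + 1) × Site (d + 1), (n κ ux.1 * dz ψ κ₂ ux.2) * E3 l t ux.1 ux.2 (Sum.inl κ) (Sum.inl κ₂)| ≤ Bn * (2 * Bψ) * C₃ * (Zl (d + 1) δ₃ * Zl (d + 1) δ₃) :=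
    fun κ κ₂ l t => abs_tsum_prod_le_of_biLoc (biLoc_weightMul (hE3 l t) (hω κ κ₂)) hδ₃ (Sum.inl κ) (Sum.inl κ₂)
  have hbd : ∀ (κ κ₂ l : Fin (d + 1)) (t : Site (d + 1)),
      |(cE * wE d Lc (j + 1)) * ∑' ux : Site (d + 1) × Site (d + 1), (n κ ux.1 * dz ψ κ₂ ux.2) * E3 l t ux.1 ux.2 (Sum.inl κ) (Sum.inl κ₂)|
        ≤ |cE * wE d Lc (j + 1)| * (Bn * (2 * Bψ) * C₃ * (Zl (d + 1) δ₃ * Zl (d + 1) δ₃)) := fun κ κ₂ l t => by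
    rw [abs_mul]; exact mul_le_mul_of_nonneg_left (hE3b κ κ₂ l t) (abs_nonneg _)
  have hsZ : ∀ κ κ₂ l, Summable fun t => colH G Lc ν y' l t
      * ((cE * wE d Lc (j + 1)) * ∑' ux : Site (d + 1) × Site (d + 1), (n κ ux.1 * dz ψ κ₂ ux.2) * E3 l t ux.1 ux.2 (Sum.inl κ) (Sum.inl κ₂)) :=
    fun κ κ₂ l => summable_colH_mul_bdd (N := Lc) hGK (hbd κ κ₂ l) ν y' l
  have hsE : ∀ κ κ₂ l, Summable fun t => colH G Lc ν y' l t
      * ∑' ux : Site (d + 1) × Site (d + 1), (n κ ux.1 * dz ψ κ₂ ux.2) * E3 l t ux.1 ux.2 (Sum.inl κ) (Sum.inl κ₂) :=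
    fun κ κ₂ l => summable_colH_mul_bdd (N := Lc) hGK (hE3b κ κ₂ l) ν y' l
  have hsp : ∀ (κ κ₂ l : Fin (d + 1)) (t : Site (d + 1)), Summable fun ux : Site (d + 1) × Site (d + 1) => (n κ ux.1 * dz ψ κ₂ ux.2) * E3 l t ux.1 ux.2 (Sum.inl κ) (Sum.inl κ₂) :=
    fun κ κ₂ l t => summable_prod_of_biLoc (biLoc_weightMul (hE3 l t) (hω κ κ₂)) hδ₃ (Sum.inl κ) (Sum.inl κ₂)
  -- regroup: channels inside, slots outside, constant in front
  calc (∑ κ, ∑ κ₂, ∑ l, ∑' t, colH G Lc ν y' l t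
          * ((cE * wE d Lc (j + 1)) * ∑' ux : Site (d + 1) × Site (d + 1), (n κ ux.1 * dz ψ κ₂ ux.2) * E3 l t ux.1 ux.2 (Sum.inl κ) (Sum.inl κ₂)))
      = ∑ l, ∑ κ, ∑ κ₂, ∑' t, colH G Lc ν y' l t
          * ((cE * wE d Lc (j + 1)) * ∑' ux : Site (d + 1) × Site (d + 1), (n κ ux.1 * dz ψ κ₂ ux.2) * E3 l t ux.1 ux.2 (Sum.inl κ) (Sum.inl κ₂)) := by
        calc _ = ∑ κ, ∑ l, ∑ κ₂, ∑' t, colH G Lc ν y' l t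
              * ((cE * wE d Lc (j + 1)) * ∑' ux : Site (d + 1) × Site (d + 1), (n κ ux.1 * dz ψ κ₂ ux.2) * E3 l t ux.1 ux.2 (Sum.inl κ) (Sum.inl κ₂)) :=
              Finset.sum_congr rfl fun κ _ => Finset.sum_comm
          _ = _ := Finset.sum_comm
    _ = ∑ l, ∑' t, ∑ κ, ∑ κ₂, colH G Lc ν y' l t
          * ((cE * wE d Lc (j + 1)) * ∑' ux : Site (d + 1) × Site (d + 1), (n κ ux.1 * dz ψ κ₂ ux.2) * E3 l t ux.1 ux.2 (Sum.inl κ) (Sum.inl κ₂)) := by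
        refine Finset.sum_congr rfl fun l _ => ?_
        rw [Summable.tsum_finsetSum (fun κ _ => summable_sum fun κ₂ _ => hsZ κ κ₂ l)]
        exact Finset.sum_congr rfl fun κ _ => (Summable.tsum_finsetSum (fun κ₂ _ => hsZ κ κ₂ l)).symm
    _ = (cE * wE d Lc (j + 1)) * ∑ l, ∑' t, colH G Lc ν y' l t
          * ∑' ux : Site (d + 1) × Site (d + 1), ∑ κ, ∑ κ₂, n κ ux.1 * dz ψ κ₂ ux.2 * E3 l t ux.1 ux.2 (Sum.inl κ) (Sum.inl κ₂) := by
        rw [Finset.mul_sum]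
        refine Finset.sum_congr rfl fun l _ => ?_
        rw [← tsum_mul_left]
        refine tsum_congr fun t => ?_
        rw [Summable.tsum_finsetSum (fun κ _ => summable_sum fun κ₂ _ => hsp κ κ₂ l t)]
        simp only [Summable.tsum_finsetSum (fun κ₂ _ => hsp _ κ₂ l t)]
        rw [Finset.mul_sum, Finset.mul_sum]
        refine Finset.sum_congr rfl fun κ _ => ?_
        rw [Finset.mul_sum, Finset.mul_sum]
        exact Finset.sum_congr rfl fun κ₂ _ => by ring

/-! ## §3 The source pairing of the full slot derivative `𝒟_{j+1}(e) = dM G_{j+1} Lc S_{j+1} M_{j+1} ν y′` -/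

/-- NOT IN PRINT; OUR BOOKKEEPING.  **THE (γ)-TYPE SOURCE PAIRING AT LEVEL `j+1`, REDUCED** (in-block root; `G_{j+1}`, `S_{j+1} = SpureRecAt … (j+1)`, `M_{j+1} = M1At … (j+1)`, slot `(ν, y′)`,
`𝒟_{j+1}(e) := dM G_{j+1} Lc S_{j+1} M_{j+1} ν y′`; `n` bounded, COMB-FREE, with VANISHING block contour sums; `ψ` bounded; every `j`, all `cE cVH cΛ`):
`Σ'_x Σ_κ₂ (dz ψ) κ₂ x·(Σ'_u Σ_κ n κ u·𝒟_{j+1}(e) u x (inl κ)(inl κ₂))`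
`= (cE·wE_{j+1})·Σ_l Σ'_t colH G_{j+1}(e) l t·(Σ'_{(u,x)} Σ_κ Σ_κ₂ n κ u·dzψ κ₂ x·e3OfK Lc G_j (SrecAt … j) l t u x (inl κ)(inl κ₂))`
`  − (cΛ·wM1_{j+1})·(2Lc^{d+1})⁻¹·Σ'_w Σ_κ 𝒬_{Lc}(σ_ψ ⊙ n) κ w·colM G_{j+1} Lc ν y′ κ w`.
The first term is the ℋ-COLUMN-CONTRACTED SECOND-LEG GAUGE PAIRING `X_{j+1}(n,ψ;e)` OF THE VALUE-FUNCTION CUBIC TABLE — the one object not in closed form in the tree (at `j+1 = 0` its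
analogue is `−½·Σ' ψ⁺⊙colH⊙(d*d n) + ¼·Σ' colH⊙d*d(σ_ψ⊙n)`, FILE A `wilsonA_gaugeLeg_charge` column-contracted); the second is the constraint-Hessian sector, verbatim FILE B's with the
level weight.  With road-P2 g43's `ExitChargeSourcePairing.gaugeCharge_exit_eq_sourcePairing` the (γ) exit⊗exit charge of the slot one level up is this expression at `n = n_m`,
`ψ = 1_{B(y)}`. -/
theorem gaugeLeg_sourcePairing_dM_succ {Lc : ℕ} [NeZero Lc] {r : Fin (d + 1) → ℕ} (hr : r ∈ box (d + 1) Lc) (cE cVH cΛ : ℝ) (j : ℕ) (ν : Fin (d + 1)) (y' : Site (d + 1))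
    {n : Form1 (d + 1) ℝ} {Bn : ℝ} (hnB : ∀ κ u, |n κ u| ≤ Bn) (hn0 : ∀ κ u, IsCombBondAt (toSite r) Lc κ u → n κ u = 0) (hq : ∀ κ y, contourSum Lc n κ y = 0)
    {ψ : Site (d + 1) → ℝ} {Bψ : ℝ} (hψ : ∀ u, |ψ u| ≤ Bψ) :
    ∑' x, ∑ κ₂, dz ψ κ₂ x * (∑' u, ∑ κ, n κ u
        * dM (coDressKBmAt (toSite r) Lc (KInvStep (d := d) Lc (j + 1))) Lc (SpureRecAt d Lc (toSite r) cE cVH cΛ (j + 1)) (M1At d Lc (toSite r) cΛ (j + 1)) ν y'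
            u x (Sum.inl κ) (Sum.inl κ₂))
      = (cE * wE d Lc (j + 1)) * (∑ l, ∑' t, colH (coDressKBmAt (toSite r) Lc (KInvStep (d := d) Lc (j + 1))) Lc ν y' l t
          * ∑' ux : Site (d + 1) × Site (d + 1), ∑ κ, ∑ κ₂, n κ ux.1 * dz ψ κ₂ ux.2
              * e3OfK Lc (coDressKBmAt (toSite r) Lc (KInvStep (d := d) Lc j)) (SrecAt d Lc (toSite r) cE cVH cΛ j) l t ux.1 ux.2 (Sum.inl κ) (Sum.inl κ₂))
        - (cΛ * wM1 d Lc (j + 1)) * (2 * (Lc : ℝ) ^ (d + 1))⁻¹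
          * ∑' w, ∑ κ, contourSum Lc (fun κ u => (ψ u + ψ (u + unitVec κ)) * n κ u) κ w * colM (coDressKBmAt (toSite r) Lc (KInvStep (d := d) Lc (j + 1))) Lc ν y' κ w := by
  classical
  have hLc : 1 ≤ Lc := one_le_of_neZero Lc
  set G := coDressKBmAt (toSite r) Lc (KInvStep (d := d) Lc (j + 1)) with hGdef
  set S := SpureRecAt d Lc (toSite r) cE cVH cΛ (j + 1) with hSdef
  set M := M1At d Lc (toSite r) cΛ (j + 1) with hMdef
  obtain ⟨δG, CG, hδG, hCG, hG⟩ := decays_coDressKBmAt_KInvStep (d := d) hr (j + 1)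
  obtain ⟨Cs, δs, hδs, hS⟩ := locStencil_SpureRecAt (d := d) (Lc := Lc) hLc hr cE cVH cΛ (j + 1)
  have hCs : 0 ≤ Cs := (hS 0 0).nonneg (Sum.inl 0)
  set δ : ℝ := min δs δG with hδdef
  have hδ : 0 < δ := lt_min hδs hδG
  have hSδ : LocStencil S Cs δ := locStencil_mono hS hCs (min_le_left _ _)
  have hMδ := vertexFamily_M1At (d := d) (Lc := Lc) hLc hr cΛ (j + 1) hδ.le
  have hW := vertexFamily_dM (N := Lc) hG hCG hSδ hMδ hδ (min_le_right _ _) ν y'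
  have hδ2 : 0 < δ / 2 := by positivity
  have hBψ : 0 ≤ Bψ := (abs_nonneg _).trans (hψ 0)
  have hω : ∀ (κ κ₂ : Fin (d + 1)) (xz : Site (d + 1) × Site (d + 1)), |n κ xz.1 * dz ψ κ₂ xz.2| ≤ Bn * (2 * Bψ) := fun κ κ₂ xz => by
    rw [abs_mul]; exact mul_le_mul (hnB κ xz.1) (abs_dz_le hψ κ₂ xz.2) (abs_nonneg _) ((abs_nonneg _).trans (hnB κ xz.1))
  -- product summability of the weighted derivative, per channel
  have hsF : ∀ κ κ₂, Summable fun ux : Site (d + 1) × Site (d + 1) => (n κ ux.1 * dz ψ κ₂ ux.2) * dM G Lc S M ν y' ux.1 ux.2 (Sum.inl κ) (Sum.inl κ₂) :=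
    fun κ κ₂ => summable_prod_of_biLoc (biLoc_weightMul hW (hω κ κ₂)) hδ2 (Sum.inl κ) (Sum.inl κ₂)
  have hsF' : Summable fun ux : Site (d + 1) × Site (d + 1) => ∑ κ, ∑ κ₂, (n κ ux.1 * dz ψ κ₂ ux.2) * dM G Lc S M ν y' ux.1 ux.2 (Sum.inl κ) (Sum.inl κ₂) :=
    summable_sum fun κ _ => summable_sum fun κ₂ _ => hsF κ κ₂
  -- columns of `𝒟(e)` are summable in the first leg
  obtain ⟨CW, hCW⟩ : ∃ CW : ℝ, BiLoc (dM G Lc S M ν y') ((Lc : ℤ) • y') ((Lc : ℤ) • y') CW (δ / 2) := ⟨_, hW⟩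
  have hcol : ∀ x κ κ₂, Summable fun u => n κ u * dM G Lc S M ν y' u x (Sum.inl κ) (Sum.inl κ₂) := by
    intro x κ κ₂
    have hC0 : 0 ≤ CW := hCW.nonneg (Sum.inl κ)
    refine Summable.of_norm_bounded (((summable_exp_shift' hδ2 ((Lc : ℤ) • y')).mul_left (Bn * CW)).mul_right
      (Real.exp (-(δ / 2) * l1 (x - (Lc : ℤ) • y')))) (fun u => ?_)
    rw [Real.norm_eq_abs, abs_mul]
    have h := hCW u x (Sum.inl κ) (Sum.inl κ₂)
    rw [mul_add, Real.exp_add] at h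
    calc |n κ u| * |dM G Lc S M ν y' u x (Sum.inl κ) (Sum.inl κ₂)|
        ≤ Bn * (CW * (Real.exp (-(δ / 2) * l1 (u - (Lc : ℤ) • y')) * Real.exp (-(δ / 2) * l1 (x - (Lc : ℤ) • y')))) :=
          mul_le_mul (hnB κ u) h (abs_nonneg _) ((abs_nonneg _).trans (hnB κ u))
      _ = Bn * CW * Real.exp (-(δ / 2) * l1 (u - (Lc : ℤ) • y')) * Real.exp (-(δ / 2) * l1 (x - (Lc : ℤ) • y')) := by ring
  -- iterated form = product form
  have e1 : ∀ x, (∑ κ₂, dz ψ κ₂ x * ∑' u, ∑ κ, n κ u * dM G Lc S M ν y' u x (Sum.inl κ) (Sum.inl κ₂))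
      = ∑' u, ∑ κ, ∑ κ₂, (n κ u * dz ψ κ₂ x) * dM G Lc S M ν y' u x (Sum.inl κ) (Sum.inl κ₂) := by
    intro x
    have hs : ∀ κ₂, Summable fun u => ∑ κ, n κ u * dM G Lc S M ν y' u x (Sum.inl κ) (Sum.inl κ₂) := fun κ₂ => summable_sum fun κ _ => hcol x κ κ₂
    have e : ∀ κ₂, dz ψ κ₂ x * ∑' u, ∑ κ, n κ u * dM G Lc S M ν y' u x (Sum.inl κ) (Sum.inl κ₂)
        = ∑' u, ∑ κ, (n κ u * dz ψ κ₂ x) * dM G Lc S M ν y' u x (Sum.inl κ) (Sum.inl κ₂) := fun κ₂ => by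
      rw [← tsum_mul_left]
      refine tsum_congr fun u => ?_
      rw [Finset.mul_sum]
      exact Finset.sum_congr rfl fun κ _ => by ring
    simp only [e]
    rw [← Summable.tsum_finsetSum (fun κ₂ _ => ((hs κ₂).mul_left (dz ψ κ₂ x)).congr fun u => by
      rw [Finset.mul_sum]; exact Finset.sum_congr rfl fun κ _ => by ring)]
    exact tsum_congr fun u => Finset.sum_comm
  rw [tsum_congr e1]
  have hsU : Summable (Function.uncurry fun u x => ∑ κ, ∑ κ₂, (n κ u * dz ψ κ₂ x) * dM G Lc S M ν y' u x (Sum.inl κ) (Sum.inl κ₂)) := hsF'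
  have e2 : ∑' x, ∑' u, ∑ κ, ∑ κ₂, (n κ u * dz ψ κ₂ x) * dM G Lc S M ν y' u x (Sum.inl κ) (Sum.inl κ₂)
      = ∑' ux : Site (d + 1) × Site (d + 1), ∑ κ, ∑ κ₂, (n κ ux.1 * dz ψ κ₂ ux.2) * dM G Lc S M ν y' ux.1 ux.2 (Sum.inl κ) (Sum.inl κ₂) := by
    rw [hsU.tsum_comm]
    exact (hsU.tsum_prod).symm
  rw [e2]
  -- split the derivative into its two chain-rule vertices
  have e3 : ∀ ux : Site (d + 1) × Site (d + 1), (∑ κ, ∑ κ₂, (n κ ux.1 * dz ψ κ₂ ux.2) * dM G Lc S M ν y' ux.1 ux.2 (Sum.inl κ) (Sum.inl κ₂))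
      = (∑ κ, ∑ κ₂, n κ ux.1 * dz ψ κ₂ ux.2 * vertexOfK G Lc S ν y' ux.1 ux.2 (Sum.inl κ) (Sum.inl κ₂))
        + ∑ κ, ∑ κ₂, n κ ux.1 * dz ψ κ₂ ux.2 * vertexOfM G Lc M ν y' ux.1 ux.2 (Sum.inl κ) (Sum.inl κ₂) := by
    intro ux
    rw [← Finset.sum_add_distrib]
    refine Finset.sum_congr rfl fun κ _ => ?_
    rw [← Finset.sum_add_distrib]
    refine Finset.sum_congr rfl fun κ₂ _ => ?_
    rw [dM_apply]; ring
  have hsK : Summable fun ux : Site (d + 1) × Site (d + 1) => ∑ κ, ∑ κ₂, n κ ux.1 * dz ψ κ₂ ux.2 * vertexOfK G Lc S ν y' ux.1 ux.2 (Sum.inl κ) (Sum.inl κ₂) :=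
    summable_sum fun κ _ => summable_sum fun κ₂ _ =>
      (hasSum_prod_weight_vertexOfK hG hCG hSδ hδ (min_le_right _ _) (hω κ κ₂) ν y' (Sum.inl κ) (Sum.inl κ₂)).summable
  have hsM : Summable fun ux : Site (d + 1) × Site (d + 1) => ∑ κ, ∑ κ₂, n κ ux.1 * dz ψ κ₂ ux.2 * vertexOfM G Lc M ν y' ux.1 ux.2 (Sum.inl κ) (Sum.inl κ₂) :=
    summable_sum fun κ _ => summable_sum fun κ₂ _ =>
      (hasSum_prod_weight_vertexOfM hLc hG hCG hMδ hδ (min_le_right _ _) (hω κ κ₂) ν y' (Sum.inl κ) (Sum.inl κ₂)).summable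
  rw [tsum_congr e3, hsK.tsum_add hsM, hGdef, hSdef, hMdef, tsum_prod_gaugeLeg_vertexOfK_succ hr cE cVH cΛ j ν y' hnB hψ,
    tsum_prod_gaugeLeg_vertexOfM_succ hr cΛ j ν y' hnB hn0 hq hψ]
  ring

end Summit.QuantumFields.BalabanUV.Beta.GAN24.GaugeReadSourcePairingSucc

end
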